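import Literature.AlgebraicGeometry.Motives.FiberNetExistence
import Literature.AlgebraicGeometry.Motives.HodgeNumberFamilySemicontinuity
import Literature.AlgebraicGeometry.HodgeTheory.HyperplaneSectionMonodromySmoothLocus
import Literature.AlgebraicGeometry.HodgeTheory.ComplexConjugationHolds
import Literature.AlgebraicGeometry.HodgeTheory.IsoTransport
import Literature.NumberTheory.Transcendental.ComplexDeRhamFinite
import Literature.NumberTheory.Transcendental.AnalytificationCompactProofs
import Literature.NumberTheory.Transcendental.AnalytificationConnectedOpen
import HarnessLib

/-!
# The Hodge numbers of the fibres of a net are constant — Voisin I Prop. 9.20 from Cor. 9.19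

Topic `Literature/AlgebraicGeometry/Motives`; theorems-only companion of `Motives/FiberNetExistence`
(the named fact `fiberNet_exists_hasFibreHodgeNumber`: for a net of `r`-folds `N` over `ℙᵐ_ℂ` and
`(k, p, q)` there is ONE `h` with `N.HasFibreHodgeNumber k p q h`, i.e. every fibre over a complex
point of the smooth base `U = ℙᵐ ∖ Δ` has a Hodge model with `dim H^{p,q} = h`). Source read:
C. Voisin, *Hodge Theory and Complex Algebraic Geometry I* (2002), §9.3 (PDF pp. 194–197).

Printed proof of Prop. 9.20 ("For `b` near `0`, we have `h^{p,q}(X_b) = h^{p,q}(X_0)`"): by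
Cor. 9.19 `h^{p,q}(X_b) ≤ h^{p,q}(X_0)` for `b` near `0`; `b_k = Σ_{p+q=k} dim E_∞^{p,q}(X_b) ≤
Σ h^{p,q}(X_b) ≤ Σ h^{p,q}(X_0) = b_k` (Ehresmann: `X_b` is diffeomorphic to `X_0`; Hodge
decomposition on the Kähler `X_0`), so all inequalities are equalities. For the smooth family
`π⁻¹(U) → U` of a net ALL fibres are projective, hence Kähler, and the argument reads: each
`s ↦ h^{p,q}(X_s)` is upper semicontinuous on `U(ℂ)` (Cor. 9.19), their sum over `p + q = k` is the
Betti number `b_k(X_s(ℂ))`, locally constant by Ehresmann's theorem, so each `h^{p,q}` is locally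
constant, hence constant on the CONNECTED `U(ℂ)` (SGA1 XII Prop. 2.4). This file PROVES exactly
that deduction, with every input a theorem of the tree except Cor. 9.19:

* `eventually_forall_eq_of_eventually_le_of_sum_eq` — finitely many `ℕ`-valued functions, each
  upper semicontinuous at `t₀`, with sum locally constant at `t₀`, are all locally constant at `t₀`;
* `sum_finrank_hodgeModel_hodgePQ_eq` — for a Hodge model `A` of a proper `X/ℂ`,
  `Σ_{p+q=k} dim A.hodgePQ k p q = dim Hᵏ(A.carrier; ℂ)` (the field `isInternal_hodgePQ`, the de Rham
  comparison `A.deRham`, finiteness of de Rham cohomology of the compact `A.carrier`);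
  `finrank_hodgeModel_hodgePQ_eq_zero_of_ne` (`H^{p,q} = 0` in degree `k ≠ p + q`);
* `finrank_singularCohomology_hodgeModel_carrier_eq` — `dim Hᵏ(A.carrier) = dim Hᵏ(f(ℂ)⁻¹(s))`
  (`A.carrier ≃ₜ 𝒳_s(ℂ) ≃ₜ f(ℂ)⁻¹(s)`, `HodgeTheory.fiberHomeomorph`);
  `eventually_finrank_singularCohomology_preimage_eq` — the Betti numbers of the topological
  fibres of a smooth proper family over a smooth base are locally constant (Ehresmann on complex
  points, `ComplexPoints.isLocallyTrivialFibration_map_of_smoothOfRelativeDimension`);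
* `exists_forall_finrank_hodgePQ_eq_of_eventually_le` — **Prop. 9.20 for a smooth projective
  family `f : 𝒳 ⟶ S` over a smooth separated base with preconnected `S(ℂ)`**, from the upper
  semicontinuity HYPOTHESIS `husc` for that family: one `h` with `dim A.hodgePQ k p q = h` for all
  `s ∈ S(ℂ)` and ALL Hodge models `A` of `𝒳_s` (models exist: `nonempty_hodgeModel_holds`);
* the net case: `U(ℂ)` is second countable and preconnected
  (`FiberNet.preconnectedSpace_complexPoints_smoothBaseOver`: `U` open in the irreducible `ℙᵐ`,
  `ComplexPoints.isConnected_setOf_pt_mem_inter_of_isIrreducible`), `U` is smooth of relative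
  dimension `m`; `FiberNet.exists_hasFibreHodgeNumber_of_eventually_le` transports along
  `fiberOverSmoothFamilyIso` / `liftSmoothBase` to the fibres `N.fiber b`, `b.pt ∈ U`;
* `fiberNet_exists_hasFibreHodgeNumber_of_upperSemicontinuous` — **the named fact from Cor. 9.19**,
  the latter taken as the explicit hypothesis `hX` spelled out in the tree's vocabulary (for every
  smooth projective family `f : 𝒳 ⟶ S` of relative dimension `n` over a smooth separated base, all
  `k p q`, `s₀ ∈ S(ℂ)` and Hodge models `A₀` of `𝒳_{s₀}`: for `s` near `s₀` and every Hodge model `A`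
  of `𝒳_s`, `dim A.hodgePQ k p q ≤ dim A₀.hodgePQ k p q`).

## What is NOT here (D-0026)

Cor. 9.19 itself (Voisin I Thm. 9.15 / Kodaira (2005) Thms. 7.3, 7.8: upper semicontinuity of
`dim Ker` for `C^∞` families of elliptic operators, applied to the relative `Δ_∂̄` after a `C^∞`
Ehresmann trivialisation; or Hartshorne III Thm. 12.8 with Serre's GAGA and Dolbeault) is a theory the
tree does not have; it is NOT vendored as a named fact by this proving unit and appears only as the
hypothesis `hX`, verbatim the statement a future Literature fact/theorem
`HodgeTheory.upperSemicontinuous_fibreHodgeNumber` would carry, so that the discharge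
`fiberNet_exists_hasFibreHodgeNumber_holds` is this file's last theorem fed with it.

## References

* C. Voisin, *Hodge Theory and Complex Algebraic Geometry I* (2002), Thm. 9.3 (Ehresmann), §9.3.1
  Thm. 9.15, Cor. 9.19, §9.3.2 Prop. 9.20; §6.1.3 Prop. 6.11. [VoisinHodgeI2002]
* K. Kodaira, *Complex Manifolds and Deformation of Complex Structures* (2005), Thms. 7.3, 7.8. [Kodaira2005]
* A. Grothendieck, M. Raynaud, SGA 1, Exp. XII Prop. 2.4, 3.1, 3.2. [SGA1]
* J.-P. Serre, GAGA, Ann. Inst. Fourier 6 (1956), §2. [SerreGAGA1956]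
-/

noncomputable section

open CategoryTheory AlgebraicGeometry Filter Topology Module Finset
open scoped Manifold ContDiff

namespace Literature.AlgebraicGeometry.Motives

open Literature.AlgebraicGeometry.HodgeTheory Literature.AlgebraicTopology.SingularHomology
  Literature.AlgebraicTopology.Homotopy Literature.NumberTheory.Transcendental

/-! ### Upper semicontinuous functions with locally constant sum -/

/-- Finitely many `ℕ`-valued functions `g i`, `i ∈ I`, on a topological space, each upper
semicontinuous at `t₀` (`g i t ≤ g i t₀` near `t₀`) and with `Σ_{i ∈ I} g i` locally constant at `t₀`,
are all locally constant at `t₀` (the step "all the inequalities are equalities" of Voisin I,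
Prop. 9.20). [folklore] -/
theorem eventually_forall_eq_of_eventually_le_of_sum_eq {T : Type*} [TopologicalSpace T]
    {ι : Type*} (I : Finset ι) (g : ι → T → ℕ) (t₀ : T)
    (husc : ∀ i ∈ I, ∀ᶠ t in 𝓝 t₀, g i t ≤ g i t₀)
    (hsum : ∀ᶠ t in 𝓝 t₀, ∑ i ∈ I, g i t = ∑ i ∈ I, g i t₀) :
    ∀ᶠ t in 𝓝 t₀, ∀ i ∈ I, g i t = g i t₀ := by
  have hall : ∀ᶠ t in 𝓝 t₀, ∀ i ∈ I, g i t ≤ g i t₀ := (Filter.eventually_all_finset I).2 husc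
  filter_upwards [hall, hsum] with t ht hts
  exact (Finset.sum_eq_sum_iff_of_le ht).1 hts

/-! ### Hodge numbers and Betti numbers of one fibre through a Hodge model -/

/-- **`Σ_{p+q=k} h^{p,q} = b_k` through a Hodge model.** For a Hodge model `A` of a proper
`ℂ`-scheme `X` (so that `A.carrier ≃ₜ X(ℂ)` is compact), `Σ_{(p,q) ∈ antidiagonal k}
dim A.hodgePQ k p q = dim_ℂ Hᵏ(A.carrier; ℂ)`: the Hodge decomposition `H^k_dR = ⨁ K^{p,q}` is the
field `isInternal_hodgePQ`, `H^k_dR(A.carrier; ℂ)` is finite-dimensional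
(`complexDeRhamCohomology.finite_of_compactSpace`), and `A.deRham` is the de Rham comparison
`H^k_dR ≃ Hᵏ`. (Voisin I, §6.1.3, p. 142: `b_k = Σ_{p+q=k} h^{p,q}`.)
[cite: VoisinHodgeI2002, §6.1.3 Prop. 6.11 and Rem. 8.29] -/
theorem sum_finrank_hodgeModel_hodgePQ_eq {n : ℕ} {X : SchemeOver ℂ} [IsProper X.hom]
    (A : HodgeModel n X) (k : ℕ) :
    ∑ pq ∈ antidiagonal k, finrank ℂ ↥(A.hodgePQ k pq.1 pq.2) =
      finrank ℂ (singularCohomology ℂ ℂ A.carrier k) := by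
  haveI : CompactSpace A.carrier := A.isAnalytification.compactSpace_of_isProper
  haveI : Module.Finite ℂ (complexDeRhamCohomology A.model A.carrier k) :=
    complexDeRhamCohomology.finite_of_compactSpace A.model A.carrier k
  have h1 : ∀ p q, finrank ℂ ↥(A.hodgePQ k p q) = finrank ℂ ↥(hodgePQ A.model A.carrier k p q) :=
    fun p q ↦ LinearEquiv.finrank_map_eq (A.deRham A.carrier k) _
  let e := LinearEquiv.ofBijective
    (DirectSum.coeLinearMap fun pq : ↥(antidiagonal k) ↦ hodgePQ A.model A.carrier k pq.1.1 pq.1.2)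
    (A.isInternal_hodgePQ k)
  rw [← (A.deRham A.carrier k).finrank_eq, ← e.finrank_eq, Module.finrank_directSum,
    ← Finset.sum_coe_sort (antidiagonal k)]
  exact Finset.sum_congr rfl fun pq _ ↦ h1 _ _

/-- Off the antidiagonal the Hodge number in degree `k` vanishes: `dim A.hodgePQ k p q = 0` for
`p + q ≠ k` (there are no `k`-forms of type `(p,q)`, `hodgePQ_eq_bot_of_ne`). [folklore] -/
theorem finrank_hodgeModel_hodgePQ_eq_zero_of_ne {n : ℕ} {X : SchemeOver ℂ} (A : HodgeModel n X)
    {k p q : ℕ} (h : p + q ≠ k) : finrank ℂ ↥(A.hodgePQ k p q) = 0 := by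
  have hbot : A.hodgePQ k p q = ⊥ := by
    rw [HodgeModel.hodgePQ, hodgePQ_eq_bot_of_ne h, Submodule.map_bot]
  rw [hbot, finrank_bot]

section Family

variable {𝒳 S : SchemeOver ℂ} (f : 𝒳 ⟶ S) {n : ℕ}

/-- **The Betti numbers of a fibre through a Hodge model**: for `f : 𝒳 ⟶ S` proper with `𝒳`
separated, `s ∈ S(ℂ)` and a Hodge model `A` of `𝒳_s`, `dim Hᵏ(A.carrier; ℂ) = dim Hᵏ(f(ℂ)⁻¹(s); ℂ)`,
along the homeomorphisms `A.carrier ≃ₜ 𝒳_s(ℂ)` (the analytification) and `𝒳_s(ℂ) ≃ₜ f(ℂ)⁻¹(s)`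
(`HodgeTheory.fiberHomeomorph`; Mumford I.10). [cite: SerreGAGA1956, §2] -/
theorem finrank_singularCohomology_hodgeModel_carrier_eq [IsProper f.left] [IsSeparated 𝒳.hom]
    (s : ComplexPoints S) (A : HodgeModel n (fiberOver f s)) (k : ℕ) :
    finrank ℂ (singularCohomology ℂ ℂ A.carrier k) =
      finrank ℂ (singularCohomology ℂ ℂ ↥(AlgPoints.map f ⁻¹' ({s} : Set (ComplexPoints S))) k) := by
  let e : A.carrier ≃ₜ ↥(AlgPoints.map f ⁻¹' ({s} : Set (ComplexPoints S))) :=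
    A.isAnalytification.homeomorph.trans (fiberHomeomorph f s)
  exact ((singularCohomology.mapIso ℂ ℂ e k).toLinearEquiv.finrank_eq).symm

/-- **The Betti numbers of the fibres of a smooth proper family are locally constant** (Ehresmann,
Voisin I Thm. 9.3: "`X_b` is diffeomorphic to `X`, we have `dim Hᵏ(X_b, ℂ) = dim Hᵏ(X, ℂ) =: b_k`").
For `f : 𝒳 ⟶ S` proper and smooth of relative dimension `n` over a base smooth of relative dimension
`m`, both separated with second countable complex points, `s ↦ dim Hᵏ(f(ℂ)⁻¹(s); ℂ)` is locally
constant on `S(ℂ)`: `f(ℂ)` is a locally trivial fibration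
(`ComplexPoints.isLocallyTrivialFibration_map_of_smoothOfRelativeDimension`), so nearby fibres are
homeomorphic (`fibreHomeomorphOfTrivialisation`). [cite: VoisinHodgeI2002, Thm. 9.3 and §9.3.2 (9.10)] -/
theorem eventually_finrank_singularCohomology_preimage_eq (m : ℕ) [SmoothOfRelativeDimension m S.hom]
    [SmoothOfRelativeDimension n f.left] [IsProper f.left] [IsSeparated 𝒳.hom] [IsSeparated S.hom]
    [SecondCountableTopology (ComplexPoints 𝒳)] [SecondCountableTopology (ComplexPoints S)]
    (k : ℕ) (s₀ : ComplexPoints S) :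
    ∀ᶠ s in 𝓝 s₀,
      finrank ℂ (singularCohomology ℂ ℂ ↥(AlgPoints.map f ⁻¹' ({s} : Set (ComplexPoints S))) k) =
        finrank ℂ (singularCohomology ℂ ℂ ↥(AlgPoints.map f ⁻¹' ({s₀} : Set (ComplexPoints S))) k) := by
  haveI : Smooth S.hom := SmoothOfRelativeDimension.smooth m _
  haveI : LocallyOfFiniteType S.hom := inferInstance
  obtain ⟨U, hUo, hsU, φ, hφ⟩ :=
    ComplexPoints.isLocallyTrivialFibration_map_of_smoothOfRelativeDimension n m f s₀
  filter_upwards [hUo.mem_nhds hsU] with s hs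
  exact ((singularCohomology.mapIso ℂ ℂ (fibreHomeomorphOfTrivialisation φ hφ hs) k)
    |>.toLinearEquiv.finrank_eq).symm

/-- **Voisin I Prop. 9.20 for a smooth projective family, from upper semicontinuity.** Let
`f : 𝒳 ⟶ S` be a smooth projective family of relative dimension `n` over a base `S` smooth of relative
dimension `m` and separated, with `𝒳(ℂ)`, `S(ℂ)` second countable and `S(ℂ)` preconnected, and suppose
Cor. 9.19 for this family (hypothesis `husc`: for all `k p q`, `s₀` and Hodge models `A₀` of `𝒳_{s₀}`,
`dim A.hodgePQ k p q ≤ dim A₀.hodgePQ k p q` for `s` near `s₀` and all Hodge models `A` of `𝒳_s`). Then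
for all `k p q` there is ONE `h` with `dim A.hodgePQ k p q = h` for every `s ∈ S(ℂ)` and every Hodge
model `A` of `𝒳_s`. Proof as printed: Hodge models exist (`nonempty_hodgeModel_holds`); at `s = s₀`
the hypothesis gives independence of the model; for chosen models the functions
`s ↦ h^{p,q}(𝒳_s)`, `p + q = k`, are upper semicontinuous with sum `b_k(𝒳_s(ℂ))`
(`sum_finrank_hodgeModel_hodgePQ_eq`, `finrank_singularCohomology_hodgeModel_carrier_eq`), which is
locally constant (`eventually_finrank_singularCohomology_preimage_eq`), hence each is locally constant
(`eventually_forall_eq_of_eventually_le_of_sum_eq`) and constant on the preconnected `S(ℂ)`; off the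
antidiagonal `h = 0`. [cite: VoisinHodgeI2002, §9.3.2 Prop. 9.20] -/
theorem exists_forall_finrank_hodgePQ_eq_of_eventually_le (m : ℕ) [SmoothOfRelativeDimension m S.hom]
    [IsSeparated S.hom] [SecondCountableTopology (ComplexPoints 𝒳)]
    [SecondCountableTopology (ComplexPoints S)] [PreconnectedSpace (ComplexPoints S)]
    (hf : IsSmoothProjectiveFamily f n)
    (husc : ∀ (k p q : ℕ) (s₀ : ComplexPoints S) (A₀ : HodgeModel n (fiberOver f s₀)),
      ∀ᶠ s in 𝓝 s₀, ∀ A : HodgeModel n (fiberOver f s),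
        finrank ℂ ↥(A.hodgePQ k p q) ≤ finrank ℂ ↥(A₀.hodgePQ k p q))
    (k p q : ℕ) :
    ∃ h : ℕ, ∀ (s : ComplexPoints S) (A : HodgeModel n (fiberOver f s)),
      finrank ℂ ↥(A.hodgePQ k p q) = h := by
  classical
  haveI : IsProper f.left := hf.isProper
  haveI : SmoothOfRelativeDimension n f.left := hf.smoothOfRelativeDimension
  haveI : IsSeparated 𝒳.hom := by rw [← Over.w f]; infer_instance
  -- a Hodge model of every fibre (the fibres are smooth projective `n`-folds)
  have hne : ∀ s : ComplexPoints S, Nonempty (HodgeModel n (fiberOver f s)) := fun s ↦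
    nonempty_hodgeModel_holds (hf.isSmoothProjective s)
  let A : ∀ s : ComplexPoints S, HodgeModel n (fiberOver f s) := fun s ↦ (hne s).some
  -- the Hodge numbers do not depend on the model (semicontinuity at `s` itself, both ways)
  have hindep : ∀ (k p q : ℕ) (s : ComplexPoints S) (A' : HodgeModel n (fiberOver f s)),
      finrank ℂ ↥(A'.hodgePQ k p q) = finrank ℂ ↥((A s).hodgePQ k p q) := fun k p q s A' ↦
    le_antisymm ((husc k p q s (A s)).self_of_nhds A') ((husc k p q s A').self_of_nhds (A s))
  -- the Hodge numbers of the chosen models, as functions on `S(ℂ)`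
  let g : ℕ × ℕ → ComplexPoints S → ℕ := fun pq s ↦ finrank ℂ ↥((A s).hodgePQ k pq.1 pq.2)
  -- locally constant on the antidiagonal `p + q = k`: u.s.c. with locally constant sum `b_k`
  have hloc : ∀ s₀ : ComplexPoints S, ∀ᶠ s in 𝓝 s₀, ∀ pq ∈ antidiagonal k, g pq s = g pq s₀ := by
    intro s₀
    refine eventually_forall_eq_of_eventually_le_of_sum_eq (antidiagonal k) g s₀ ?_ ?_
    · intro pq _
      exact (husc k pq.1 pq.2 s₀ (A s₀)).mono fun s hs ↦ hs (A s)
    · refine (eventually_finrank_singularCohomology_preimage_eq f m k s₀ (n := n)).mono fun s hs ↦ ?_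
      change ∑ pq ∈ antidiagonal k, finrank ℂ ↥((A s).hodgePQ k pq.1 pq.2) =
        ∑ pq ∈ antidiagonal k, finrank ℂ ↥((A s₀).hodgePQ k pq.1 pq.2)
      haveI : IsProper (fiberOver f s).hom := isProper_fiberOver_hom f s
      haveI : IsProper (fiberOver f s₀).hom := isProper_fiberOver_hom f s₀
      rw [sum_finrank_hodgeModel_hodgePQ_eq, sum_finrank_hodgeModel_hodgePQ_eq,
        finrank_singularCohomology_hodgeModel_carrier_eq f s (A s) k,
        finrank_singularCohomology_hodgeModel_carrier_eq f s₀ (A s₀) k, hs]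
  by_cases hpq : p + q = k
  · have hlc : IsLocallyConstant (g (p, q)) := by
      rw [IsLocallyConstant.iff_eventually_eq]
      intro s₀
      exact (hloc s₀).mono fun s hs ↦ hs (p, q) (by simpa using hpq)
    by_cases hS : Nonempty (ComplexPoints S)
    · obtain ⟨s₁⟩ := hS
      refine ⟨g (p, q) s₁, fun s A' ↦ ?_⟩
      rw [hindep k p q s A']
      exact hlc.apply_eq_of_preconnectedSpace s s₁
    · exact ⟨0, fun s _ ↦ (hS ⟨s⟩).elim⟩
  · exact ⟨0, fun s A' ↦ finrank_hodgeModel_hodgePQ_eq_zero_of_ne A' hpq⟩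

end Family

/-! ### The smooth family of a net over `ℙᵐ_ℂ` -/

/-- `ℙᵐ(ℂ)` is second countable (`ℙᵐ_ℂ` is of finite type: proper, hence quasi-compact;
`ComplexPoints.secondCountableTopology_of_compactSpace_holds`). [cite: SerreGAGA1956, §2] -/
theorem secondCountableTopology_complexPoints_projectiveSpace (m : ℕ) :
    SecondCountableTopology (ComplexPoints (projectiveSpace m ℂ)) := by
  haveI : IsProper (projectiveSpace m ℂ).hom := isProper_projectiveSpace m ℂ
  haveI : CompactSpace (projectiveSpace m ℂ).left :=
    QuasiCompact.compactSpace_of_compactSpace (projectiveSpace m ℂ).hom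
  exact ComplexPoints.secondCountableTopology_of_compactSpace_holds _

section Net

variable {r m : ℕ} {X : SchemeOver ℂ} (N : FiberNet r m X)

namespace FiberNet

/-- The smooth base `U ⊆ ℙᵐ_ℂ` of a net is smooth over `ℂ` of relative dimension `m` (open
immersion into `ℙᵐ`, `isSmoothProjective_projectiveSpace_holds`). [folklore] -/
theorem smoothOfRelativeDimension_smoothBaseOver_hom :
    SmoothOfRelativeDimension m N.smoothBaseOver.hom := by
  haveI : SmoothOfRelativeDimension m (projectiveSpace m ℂ).hom :=
    (isSmoothProjective_projectiveSpace_holds ℂ m).smoothOfRelativeDimension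
  have h : SmoothOfRelativeDimension (0 + m) (N.smoothBase.ι ≫ (projectiveSpace m ℂ).hom) :=
    inferInstance
  rw [Nat.zero_add] at h
  exact h

/-- `X̃(ℂ)` is second countable (`X̃` projective, hence of finite type). [cite: SerreGAGA1956, §2] -/
theorem secondCountableTopology_complexPoints_total :
    SecondCountableTopology (ComplexPoints N.total) := by
  haveI : IsProper N.total.hom := N.isProper_total_hom
  haveI : CompactSpace N.total.left := QuasiCompact.compactSpace_of_compactSpace N.total.hom
  exact ComplexPoints.secondCountableTopology_of_compactSpace_holds _

/-- `π⁻¹(U)(ℂ)` is second countable: `π⁻¹(U)(ℂ) ↪ X̃(ℂ)` is an (open) embedding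
(`AlgPoints.isOpenEmbedding_map_holds`). [cite: SGA1, Exp. XII Prop. 3.1 (xi)] -/
theorem secondCountableTopology_complexPoints_smoothTotal :
    SecondCountableTopology (ComplexPoints N.smoothTotal) := by
  haveI := N.secondCountableTopology_complexPoints_total
  haveI : IsOpenImmersion N.smoothTotalι.left :=
    inferInstanceAs (IsOpenImmersion (N.proj.left ⁻¹ᵁ N.smoothBase).ι)
  exact (AlgPoints.isOpenEmbedding_map_holds N.smoothTotalι).isEmbedding.secondCountableTopology

/-- `U(ℂ)` is second countable: `U(ℂ) ↪ ℙᵐ(ℂ)` is an (open) embedding.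
[cite: SGA1, Exp. XII Prop. 3.1 (xi)] -/
theorem secondCountableTopology_complexPoints_smoothBaseOver :
    SecondCountableTopology (ComplexPoints N.smoothBaseOver) := by
  haveI := secondCountableTopology_complexPoints_projectiveSpace m
  haveI : IsOpenImmersion N.smoothBaseι.left := inferInstanceAs (IsOpenImmersion N.smoothBase.ι)
  exact (AlgPoints.isOpenEmbedding_map_holds N.smoothBaseι).isEmbedding.secondCountableTopology

/-- The image of `U(ℂ) ↪ ℙᵐ(ℂ)` is the set of complex points of `ℙᵐ` lying in `U`
(`AlgPoints.range_map_of_isOpenImmersion_holds`). [cite: SGA1, Exp. XII Thm. 1.1, proof a)] -/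
theorem range_map_smoothBaseι :
    Set.range (AlgPoints.map N.smoothBaseι :
        ComplexPoints N.smoothBaseOver → ComplexPoints (projectiveSpace m ℂ)) =
      {b | b.pt ∈ N.smoothBase} := by
  haveI : IsOpenImmersion N.smoothBaseι.left := inferInstanceAs (IsOpenImmersion N.smoothBase.ι)
  rw [AlgPoints.range_map_of_isOpenImmersion_holds N.smoothBaseι]
  ext Q
  change Q.pt ∈ (N.smoothBase.ι.opensRange : Set (projectiveSpace m ℂ).left) ↔ Q.pt ∈ N.smoothBase
  rw [Scheme.Opens.opensRange_ι]
  exact Iff.rfl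

/-- **`U(ℂ)` is connected** (possibly empty): `U` is an open part of the irreducible `ℙᵐ_ℂ`, so
the set `{b ∈ ℙᵐ(ℂ) | b.pt ∈ U}` of its complex points is connected in the analytic topology
(SGA1 XII Prop. 2.4 / Shafarevich VII §2 Thm. 7.1, the tree's
`ComplexPoints.isConnected_setOf_pt_mem_inter_of_isIrreducible`), and it is the image of the embedding
`U(ℂ) ↪ ℙᵐ(ℂ)`. [cite: SGA1, Exp. XII Prop. 2.4] -/
theorem preconnectedSpace_complexPoints_smoothBaseOver :
    PreconnectedSpace (ComplexPoints N.smoothBaseOver) := by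
  haveI : IsOpenImmersion N.smoothBaseι.left := inferInstanceAs (IsOpenImmersion N.smoothBase.ι)
  have hemb := (AlgPoints.isOpenEmbedding_map_holds (L := ℂ) N.smoothBaseι).isEmbedding
  by_cases hU : (N.smoothBase : Set (projectiveSpace m ℂ).left).Nonempty
  · haveI : SmoothOfRelativeDimension m (projectiveSpace m ℂ).hom :=
      (isSmoothProjective_projectiveSpace_holds ℂ m).smoothOfRelativeDimension
    haveI : Smooth (projectiveSpace m ℂ).hom := SmoothOfRelativeDimension.smooth m _
    haveI : LocallyOfFiniteType (projectiveSpace m ℂ).hom := inferInstance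
    haveI : IrreducibleSpace (projectiveSpace m ℂ).left :=
      haveI := (isSmoothProjective_projectiveSpace_holds ℂ m).geometricallyIrreducible
      GeometricallyIrreducible.irreducibleSpace_of_subsingleton (projectiveSpace m ℂ).hom
    have hconn := ComplexPoints.isConnected_setOf_pt_mem_inter_of_isIrreducible (projectiveSpace m ℂ)
      isClosed_univ (IrreducibleSpace.isIrreducible_univ _) N.smoothBase (by simpa using hU)
    have hrange : Set.range (AlgPoints.map N.smoothBaseι :
        ComplexPoints N.smoothBaseOver → ComplexPoints (projectiveSpace m ℂ)) =
        {P | P.pt ∈ (Set.univ : Set (projectiveSpace m ℂ).left) ∧ P.pt ∈ (N.smoothBase : Set _)} := by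
      rw [range_map_smoothBaseι]
      ext P
      simp only [Set.mem_setOf_eq, Set.mem_univ, true_and]
      exact Iff.rfl
    have hpre : IsPreconnected (Set.range (AlgPoints.map N.smoothBaseι :
        ComplexPoints N.smoothBaseOver → ComplexPoints (projectiveSpace m ℂ))) := by
      rw [hrange]
      exact hconn.isPreconnected
    rw [← Set.image_univ, hemb.isInducing.isPreconnected_image] at hpre
    exact ⟨hpre⟩
  · have hempty : IsEmpty (ComplexPoints N.smoothBaseOver) := by
      refine ⟨fun s ↦ hU ⟨(AlgPoints.map N.smoothBaseι s).pt, ?_⟩⟩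
      have hs : AlgPoints.map N.smoothBaseι s ∈ Set.range (AlgPoints.map N.smoothBaseι) := ⟨s, rfl⟩
      rw [range_map_smoothBaseι] at hs
      exact hs
    exact ⟨Set.subsingleton_of_subsingleton.isPreconnected⟩

/-- **Prop. 9.20 for the smooth family `π⁻¹(U) → U` of a net**, from Cor. 9.19 for that family
(hypothesis `husc`): for all `k p q` there is one `h` with `dim A.hodgePQ k p q = h` for every
`s ∈ U(ℂ)` and every Hodge model `A` of the fibre `X̃_s` (`exists_forall_finrank_hodgePQ_eq_of_eventually_le`
with the instances of this section: `U` smooth of relative dimension `m`, separated, `U(ℂ)` and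
`π⁻¹(U)(ℂ)` second countable, `U(ℂ)` preconnected). [cite: VoisinHodgeI2002, §9.3.2 Prop. 9.20] -/
theorem exists_forall_finrank_hodgePQ_smoothFamily_eq
    (husc : ∀ (k p q : ℕ) (s₀ : ComplexPoints N.smoothBaseOver)
      (A₀ : HodgeModel r (fiberOver N.smoothFamily s₀)),
      ∀ᶠ s in 𝓝 s₀, ∀ A : HodgeModel r (fiberOver N.smoothFamily s),
        finrank ℂ ↥(A.hodgePQ k p q) ≤ finrank ℂ ↥(A₀.hodgePQ k p q))
    (k p q : ℕ) :
    ∃ h : ℕ, ∀ (s : ComplexPoints N.smoothBaseOver) (A : HodgeModel r (fiberOver N.smoothFamily s)),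
      finrank ℂ ↥(A.hodgePQ k p q) = h := by
  haveI := N.smoothOfRelativeDimension_smoothBaseOver_hom
  haveI := N.isSeparated_smoothBaseOver_hom
  haveI := N.secondCountableTopology_complexPoints_smoothTotal
  haveI := N.secondCountableTopology_complexPoints_smoothBaseOver
  haveI := N.preconnectedSpace_complexPoints_smoothBaseOver
  exact exists_forall_finrank_hodgePQ_eq_of_eventually_le N.smoothFamily m
    N.isSmoothProjectiveFamily_smoothFamily husc k p q

/-- **`∃ h, N.HasFibreHodgeNumber k p q h` from Cor. 9.19 for the smooth family of `N`.** A complex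
point `b` of `ℙᵐ` with `b.pt ∈ U` lifts to `s ∈ U(ℂ)` (`liftSmoothBase`), the fibre `X̃_s` of the
smooth family is the fibre `N.fiber b` (`fiberOverSmoothFamilyIso`), and a Hodge model transported
along that isomorphism keeps its carrier, comparison and `H^{p,q}` (cf. `nonempty_hodgeModel_iff_of_iso`).
[cite: VoisinHodgeI2002, §9.3.2 Prop. 9.20] -/
theorem exists_hasFibreHodgeNumber_of_eventually_le
    (husc : ∀ (k p q : ℕ) (s₀ : ComplexPoints N.smoothBaseOver)
      (A₀ : HodgeModel r (fiberOver N.smoothFamily s₀)),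
      ∀ᶠ s in 𝓝 s₀, ∀ A : HodgeModel r (fiberOver N.smoothFamily s),
        finrank ℂ ↥(A.hodgePQ k p q) ≤ finrank ℂ ↥(A₀.hodgePQ k p q))
    (k p q : ℕ) :
    ∃ h : ℕ, N.HasFibreHodgeNumber k p q h := by
  obtain ⟨h, hh⟩ := N.exists_forall_finrank_hodgePQ_smoothFamily_eq husc k p q
  refine ⟨h, fun b hb ↦ ?_⟩
  rw [← N.liftSmoothBase_comp_smoothBaseι b hb]
  set s := N.liftSmoothBase b hb
  obtain ⟨A'⟩ : Nonempty (HodgeModel r (fiberOver N.smoothFamily s)) :=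
    nonempty_hodgeModel_holds (N.isSmoothProjectiveFamily_smoothFamily.isSmoothProjective s)
  let e := N.fiberOverSmoothFamilyIso s
  exact ⟨{ A' with
      toComplexPoints := AlgPoints.map e.hom ∘ A'.toComplexPoints
      isAnalytification := A'.isAnalytification.transport_iso e }, hh s A'⟩

end FiberNet

/-- **Voisin I Prop. 9.20 for nets — the named fact `fiberNet_exists_hasFibreHodgeNumber` from
Cor. 9.19.** If the Hodge numbers of the fibres of every smooth projective family over a smooth
separated base are upper semicontinuous (hypothesis `hX`, Voisin I Thm. 9.15 / Cor. 9.19 in the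
tree's vocabulary: for `s` near `s₀`, `dim A.hodgePQ k p q ≤ dim A₀.hodgePQ k p q` for all Hodge
models `A` of `𝒳_s`, `A₀` of `𝒳_{s₀}`), then for every net of `r`-folds `N` over `ℙᵐ_ℂ` and all
`k p q` there is one `h` with `N.HasFibreHodgeNumber k p q h` (applied to the smooth projective family
`N.smoothFamily : π⁻¹(U) ⟶ U`, `FiberNet.isSmoothProjectiveFamily_smoothFamily`). Relies on: the
hypothesis `hX` only (everything else is proved in the tree).
[cite: VoisinHodgeI2002, §9.3.1 Cor. 9.19 and §9.3.2 Prop. 9.20] -/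
theorem fiberNet_exists_hasFibreHodgeNumber_of_upperSemicontinuous
    (hX : ∀ (n m : ℕ) ⦃𝒳 S : SchemeOver ℂ⦄ (f : 𝒳 ⟶ S) [SmoothOfRelativeDimension m S.hom]
      [IsSeparated S.hom], IsSmoothProjectiveFamily f n →
      ∀ (k p q : ℕ) (s₀ : ComplexPoints S) (A₀ : HodgeModel n (fiberOver f s₀)),
        ∀ᶠ s in 𝓝 s₀, ∀ A : HodgeModel n (fiberOver f s),
          finrank ℂ ↥(A.hodgePQ k p q) ≤ finrank ℂ ↥(A₀.hodgePQ k p q)) :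
    fiberNet_exists_hasFibreHodgeNumber := by
  intro r m X N k p q
  haveI := N.smoothOfRelativeDimension_smoothBaseOver_hom
  haveI := N.isSeparated_smoothBaseOver_hom
  exact N.exists_hasFibreHodgeNumber_of_eventually_le
    (hX r m N.smoothFamily N.isSmoothProjectiveFamily_smoothFamily) k p q

/-! ### Cor. 9.19 for the smooth family of a net, and the discharge of the named fact -/

namespace FiberNet

/-- **Voisin I Cor. 9.19 for the smooth family `π⁻¹(U) → U` of a net of `r`-folds**: for all
`k p q`, every `s₀ ∈ U(ℂ)` and every Hodge model `A₀` of `X̃_{s₀}`, `dim A.hodgePQ k p q ≤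
dim A₀.hodgePQ k p q` for `s` near `s₀` and every Hodge model `A` of `X̃_s` (the tree's
`eventually_finrank_hodgePQ_le_of_isOpenImmersion` for the smooth projective family `N.smoothFamily`
over the smooth separated base `U`, with the open immersion `π⁻¹(U) ↪ X̃` into the smooth projective
total space). [cite: VoisinHodgeI2002, §9.3.1 Cor. 9.19 and §9.3.2 Prop. 9.20] -/
theorem eventually_finrank_hodgePQ_le (k p q : ℕ) (s₀ : ComplexPoints N.smoothBaseOver)
    (A₀ : HodgeModel r (fiberOver N.smoothFamily s₀)) :
    ∀ᶠ s in 𝓝 s₀, ∀ A : HodgeModel r (fiberOver N.smoothFamily s),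
      finrank ℂ ↥(A.hodgePQ k p q) ≤ finrank ℂ ↥(A₀.hodgePQ k p q) := by
  haveI := N.smoothOfRelativeDimension_smoothBaseOver_hom
  haveI := N.isSeparated_smoothBaseOver_hom
  haveI := N.secondCountableTopology_complexPoints_smoothTotal
  haveI := N.secondCountableTopology_complexPoints_smoothBaseOver
  haveI : IsOpenImmersion N.smoothTotalι.left :=
    inferInstanceAs (IsOpenImmersion (N.proj.left ⁻¹ᵁ N.smoothBase).ι)
  exact eventually_finrank_hodgePQ_le_of_isOpenImmersion N.smoothFamily
    N.isSmoothProjectiveFamily_smoothFamily N.isSmoothProjective_total (Nat.add_comm m r)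
    N.smoothTotalι k p q s₀ A₀

end FiberNet

/-- **Voisin I Prop. 9.20 for nets — discharge of the named fact
`fiberNet_exists_hasFibreHodgeNumber`.** For every net of `r`-folds `N` over `ℙᵐ_ℂ` and all
`k p q` there is one `h` with `N.HasFibreHodgeNumber k p q h`: the fibrewise upper semicontinuity of
the Hodge numbers of the smooth family of `N` (`FiberNet.eventually_finrank_hodgePQ_le`, Cor. 9.19)
fed to `FiberNet.exists_hasFibreHodgeNumber_of_eventually_le` (Prop. 9.20: with the constancy of
the Betti numbers the Hodge numbers are locally constant, hence constant on the connected `U(ℂ)`).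
[cite: VoisinHodgeI2002, §9.3.1 Cor. 9.19 and §9.3.2 Prop. 9.20] -/
theorem fiberNet_exists_hasFibreHodgeNumber_holds : fiberNet_exists_hasFibreHodgeNumber :=
  fun _ _ _ N k p q ↦ N.exists_hasFibreHodgeNumber_of_eventually_le N.eventually_finrank_hodgePQ_le k p q

end Net

end Literature.AlgebraicGeometry.Motives

end
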